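import Summits.QuantumFields.YangMills.Theorems.UnitScaleTiltProp8ChartKernelFlatAssembly
import Summits.QuantumFields.YangMills.Theorems.UnitScaleTiltProp8ChartDoubleBarDiffBall
import Summits.QuantumFields.YangMills.Theorems.UnitScaleTiltProp8ChartRemainderColumnLetter
import HarnessLib

/-!
# Route `UnitScaleTilt`, crux K1 «MinimiserStabilityRegPr» (stmt-QuantumFields-19200), stub V2′ `stub_halvingStep`, C_E node after RULING g26-№6 — (S4′) DELIVERED:
# **THE (X2-C′-KERNEL) ROW FOR THE DOUBLE-BAR CHART OF RECORD `chartLogFlat`, AS DISPLAYED** — for every `L`-member, every admissible cube sequence, the weights of record and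
# every `Y` of weighted size `≤ ρ ≤ R♭(L)`: `‖fderiv ℂ (chartLogFlat η D − fderiv ℂ (chartLogFlat η D) 0) Y (e_b M) (j,c)‖ ≤ C₃♭(L)·ρ·η·(Lʲ)⁻²·‖M‖`, k-UNIFORMLY
# ([Balaban1985Averaging] Prop. 5 (157) for print's double-bar functional; replaces WANTED №g26-2)

Cell `ym3-torus` (HUMAN RULING D-0037: YM₃ on the torus is ladder rung R3, not the Clay problem), width seat `ym-ust-19936-w5` gen 3; `--supports stmt-QuantumFields-19200
--as helper`; def-free, 0 sorry.  ★★OWNER ACK 20 (a): «(S4′) GO».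

WHY.  RULING g26-№4: the kernel row is FALSE for the single-bar chart (j-flat second-order gauge term; evidence 19200 #43∕#47).  RULING g26-№6 re-based the H-side C_E node on
print's double-bar chart `chartLogFlat` (✓p610309) and asked (S4)∕(S4′) for the row AS DISPLAYED in ✓p608316 `ChartRemainderColumnLetter.hCcol_fderiv_of_kernel157`'s `hK`,
with `chartLog ↦ chartLogFlat`.  This file is that row: ✓`hasDerivAt_logTower_kernel_bound` (generic (157), F3c) read at the T³ carrier through (i) truncation of `Y` to the
read cone of the index (✓`chartLogFlat_congr`), (ii) the weighted-ball letter ✓`weighted_read_bound_of_adm22` (`η·Lʲ·‖Y_b‖ ≤ L·ρ` on the cone ⇒ global log-size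
`r₀ = Lρ·(Lʲ)⁻¹` of the truncation), (iii) hCd♭ ✓`differentiableOn_chartLogFlat_weightedBall_of_adm22` (to read `fderiv` as the `t`-derivative along `Y + t·e_bM`), (iv) CERT-2
✓`fderiv_chartLogFlat_zero_apply` (the flat part IS the tube), and, off the read set, derivative locality (✓`fderiv_apply_eq_zero_of_const_line` + ✓`chartLogFlat_add_of_vanish_on_read`).
WHAT.  `isOpen_weightedBall'`; ★★★ `kernel157_flat` — for `F : T3Family`, any `n K`, `D` with `D.k = K − n`, `Adm22 D R′ M`,
`2L ≤ R′M + 1`, `IsLevWeight F n K D w`, `0 ≤ ρ` with the four k-free windows `121600ℓ²·L·ρ ≤ 1`, `51200ℓ·L·ρ ≤ 1`, `A′·16·L·ρ ≤ 1/12`, `L·ρ ≤ 1/20` (`ℓ = 5L`,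
`A′ = 6144000ℓ²L` at `d = 3`), every `Y` with `w 1 b·‖Y b‖ ≤ ρ`, every fine bond `b`, matrix `M`, index `i = (j,c)`:
**`‖fderiv ℂ (fun A => chartLogFlat η D A − fderiv ℂ (chartLogFlat η D) 0 A) Y (Pi.single b M) i‖ ≤ (16·A′·L/(1 − 2/L − 1/12))·ρ·η·((Lʲ)⁻¹)²·‖M‖`**, `η = (L⁻¹)^{K−n}`.
HONEST SCOPE.  The analytic row only; the column letter (X2-C′)♭ is ★w8's ✓p608316 §3–§5 re-read for `chartLogFlat` ((S4)).  NOT a claim about the stub, the crux, the rung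
or the mass gap.

References: T. Bałaban, CMP **98** (1985) 17–51 [Balaban1985Averaging] (Prop. 5 (156)–(157) p.42); CMP **102** (1985) 277–309 [Balaban1985Variational] ((72)–(73) p.289).
-/

noncomputable section

open scoped BigOperators Matrix.Norms.L2Operator
open NormedSpace Metric Filter Topology Set

namespace Summit.QuantumFields.YangMills.Theorems.ChartKernelFlat

open Literature.MathematicalPhysics.QuantumFieldTheory.Balaban1983to89
open T4Continuum BlockAveraging MatrixLog
open LatticeFieldCalculus (bondAvg bondAvgIter)
open B5Eq118OneStroke (iterBlockOf)
open B6SectADomainsV1 (Domains)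
open B6SectAOperatorsV1 (BondIdx)
open T3ContinuumYM3Torus (T3Family)
open Summit.QuantumFields.YangMills.Theorems.FlatCubeOpsText (Adm22 IsLevWeight)
open Summit.QuantumFields.YangMills.Theorems.Prop8Chart (isUnit_exp_I_eta expCfg coe_expCfg weighted_read_bound_of_adm22)
open Summit.QuantumFields.YangMills.Theorems.Prop8ChartDoubleBar
open Summit.QuantumFields.YangMills.Theorems.ChartKernelTube

variable (F : T3Family) (n K : ℕ)

/-- The weighted ball of the level weights is open (finite intersection of open half-spaces). [folklore] -/
theorem isOpen_weightedBall' (w : ℕ → PBond (F.P K) 0 → ℝ) (R : ℝ) :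
    IsOpen {Y : PBond (F.P K) 0 → Matrix (Fin 2) (Fin 2) ℂ | ∀ b, w 1 b * ‖Y b‖ < R} := by
  have : {Y : PBond (F.P K) 0 → Matrix (Fin 2) (Fin 2) ℂ | ∀ b, w 1 b * ‖Y b‖ < R} =
      ⋂ b, {Y : PBond (F.P K) 0 → Matrix (Fin 2) (Fin 2) ℂ | w 1 b * ‖Y b‖ < R} := by ext Y; simp
  rw [this]
  exact isOpen_iInter_of_finite fun b => isOpen_lt (continuous_const.mul (continuous_apply b).norm) continuous_const

/-- ★★★ **THE (X2-C′-KERNEL) ROW FOR THE DOUBLE-BAR CHART, AS DISPLAYED** ([Balaban1985Averaging] Prop. 5 (157) for print's functional on the T³ carrier): for every `L`-member `F`,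
heights `n, K`, a nested family `D` (`D.k = K − n`) admissible `Adm22 D R′ M` with `2L ≤ R′M + 1`, the weights of record `w`, `0 ≤ ρ` within the k-free windows
`121600·(5L)²·L·ρ ≤ 1`, `51200·(5L)·L·ρ ≤ 1`, `A′·(16·L·ρ) ≤ 1/12`, `L·ρ ≤ 1/20` (`A′ := (2560ℓ/(400ℓ)⁻¹)·6/(L²(L³)⁻¹)`, `ℓ = 5L`), every `Y` with `w 1 b·‖Y b‖ ≤ ρ` for all `b`,
every fine bond `b`, matrix `M` and index `i = (j, c)`:
`‖fderiv ℂ (fun A => chartLogFlat η D A − fderiv ℂ (chartLogFlat η D) 0 A) Y (Pi.single b M) i‖ ≤ (16·A′·L/(1 − 2/L − 1/12))·ρ·η·((Lʲ)⁻¹)²·‖M‖`, `η = (L⁻¹)^{K−n}` —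
exactly the `hK` letter of ✓`ChartRemainderColumnLetter.hCcol_fderiv_of_kernel157` for `chartLogFlat`, with `C₃♭(L) := 16·A′·L/(1 − 2/L − 1/12)` depending on `L` only.
[cite: Balaban1985Averaging, Prop. 5 (157) p.42; Balaban1985Variational, (72)-(73) p.289] -/
theorem kernel157_flat (D : Domains (F.P K)) (hDk : D.k = K - n) {R' Mb : ℕ} (hAdm : Adm22 D R' Mb) (hRM : 2 * (F.P K).L ≤ R' * Mb + 1)
    {w : ℕ → PBond (F.P K) 0 → ℝ} (hw : IsLevWeight F n K D w) {ρ : ℝ} (hρ0 : 0 ≤ ρ)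
    (hwin1 : 121600 * ((((F.P K).d + 2) * (F.P K).L : ℕ) : ℝ) ^ 2 * (F.L : ℝ) * ρ ≤ 1)
    (hwin2 : 51200 * ((((F.P K).d + 2) * (F.P K).L : ℕ) : ℝ) * (F.L : ℝ) * ρ ≤ 1)
    (hwin3 : (2560 * ((((F.P K).d + 2) * (F.P K).L : ℕ) : ℝ) / (400 * ((((F.P K).d + 2) * (F.P K).L : ℕ) : ℝ))⁻¹) * (2 * ((F.P K).d : ℝ)) /
        ((F.L : ℝ) ^ 2 * ((F.L : ℝ) ^ (F.P K).d)⁻¹) * (16 * ((F.L : ℝ) * ρ)) ≤ 1 / 12)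
    (hwin4 : (F.L : ℝ) * ρ ≤ 1 / 20)
    (Y : PBond (F.P K) 0 → Matrix (Fin 2) (Fin 2) ℂ) (hY : ∀ b, w 1 b * ‖Y b‖ ≤ ρ)
    (b : PBond (F.P K) 0) (Mm : Matrix (Fin 2) (Fin 2) ℂ) (i : BondIdx D) :
    ‖fderiv ℂ (fun A : PBond (F.P K) 0 → Matrix (Fin 2) (Fin 2) ℂ =>
          chartLogFlat (((F.L : ℝ)⁻¹) ^ (K - n)) D A -
            fderiv ℂ (chartLogFlat (((F.L : ℝ)⁻¹) ^ (K - n)) D :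
              (PBond (F.P K) 0 → Matrix (Fin 2) (Fin 2) ℂ) → BondIdx D → Matrix (Fin 2) (Fin 2) ℂ) 0 A) Y (Pi.single b Mm) i‖ ≤
      (16 * ((2560 * ((((F.P K).d + 2) * (F.P K).L : ℕ) : ℝ) / (400 * ((((F.P K).d + 2) * (F.P K).L : ℕ) : ℝ))⁻¹) * (2 * ((F.P K).d : ℝ)) /
        ((F.L : ℝ) ^ 2 * ((F.L : ℝ) ^ (F.P K).d)⁻¹)) * (F.L : ℝ) / (1 - 2 / (F.L : ℝ) - 1 / 12)) *
        ρ * ((F.L : ℝ)⁻¹) ^ (K - n) * (((F.L : ℝ) ^ (i.1.1 : ℕ))⁻¹) ^ 2 * ‖Mm‖ := by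
  -- letters
  set η : ℝ := ((F.L : ℝ)⁻¹) ^ (K - n) with hη
  set Lr : ℝ := (F.L : ℝ) with hLr
  set ℓ : ℝ := ((((F.P K).d + 2) * (F.P K).L : ℕ) : ℝ) with hℓ
  set A' : ℝ := (2560 * ℓ / (400 * ℓ)⁻¹) * (2 * ((F.P K).d : ℝ)) / (Lr ^ 2 * (Lr ^ (F.P K).d)⁻¹) with hA'
  set J : ℕ := (i.1.1 : ℕ) with hJdef
  set cJ : PBond (F.P K) J := i.1.2 with hcJ
  set E : PBond (F.P K) 0 → Matrix (Fin 2) (Fin 2) ℂ := Pi.single b Mm with hE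
  set CL : (PBond (F.P K) 0 → Matrix (Fin 2) (Fin 2) ℂ) → BondIdx D → Matrix (Fin 2) (Fin 2) ℂ := chartLogFlat η D with hCL
  have hPL : ((F.P K).L : ℝ) = Lr := by rw [hLr]; rfl
  have hPd : (F.P K).d = 3 := rfl
  -- an odd `L > 1` is at least `3` (also ✓`CritCurvGradLog.three_le_L`, not imported to keep this file's closure small)
  have hL3 : 3 ≤ (F.P K).L := by obtain ⟨⟨k, hk⟩, h1⟩ := F.hL; show 3 ≤ F.L; omega
  have hL3r : (3 : ℝ) ≤ Lr := by rw [hLr]; exact_mod_cast hL3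
  have hL0 : (0 : ℝ) < Lr := by linarith
  have hη0 : 0 < η := by rw [hη]; positivity
  have hℓ1 : (1 : ℝ) ≤ ℓ := by
    rw [hℓ]; exact_mod_cast Nat.one_le_iff_ne_zero.mpr (Nat.mul_ne_zero (by omega) (F.P K).L_pos.ne')
  have hA'0 : 0 ≤ A' := by rw [hA']; positivity
  have hJK : J ≤ (F.P K).m + (F.P K).K := (Nat.lt_succ_iff.mp i.1.1.isLt).trans D.hk
  have hden : 0 < 1 - 2 / Lr - 1 / 12 := by
    have : 2 / Lr ≤ 2 / 3 := div_le_div_of_nonneg_left (by norm_num) (by norm_num) hL3r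
    linarith
  have hRHS0 : 0 ≤ (16 * A' * Lr / (1 - 2 / Lr - 1 / 12)) * ρ * η * ((Lr ^ J)⁻¹) ^ 2 * ‖Mm‖ :=
    mul_nonneg (mul_nonneg (mul_nonneg (mul_nonneg (div_nonneg (by positivity) hden.le) hρ0) hη0.le) (by positivity)) (norm_nonneg _)
  -- the chart is differentiable at `Y` (hCd♭ on the weighted ball of radius `2ρ′`)
  have hstep : ∀ (j : ℕ), j + 1 ≤ (F.P K).m + (F.P K).K → ∀ (S : GaugeField (F.P K) j (Matrix (Fin 2) (Fin 2) ℂ)ˣ) (c : PBond (F.P K) (j + 1)) (s : ℝ), 0 ≤ s →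
      48 * ((((F.P K).d + 2) * (F.P K).L : ℕ) : ℝ) * s ≤ 1 →
      (∀ b : PBond (F.P K) j, (blockOf b.src = c.src ∨ blockOf b.src = c.tgt) → (blockOf b.tgt = c.src ∨ blockOf b.tgt = c.tgt) →
        ‖((S b : (Matrix (Fin 2) (Fin 2) ℂ)ˣ) : Matrix (Fin 2) (Fin 2) ℂ) - 1‖ ≤ s) →
      ‖((dbarAvgU S c : (Matrix (Fin 2) (Fin 2) ℂ)ˣ) : Matrix (Fin 2) (Fin 2) ℂ) - 1‖ ≤ ((F.P K).L : ℝ) * s + 3800 * ((((F.P K).d + 2) * (F.P K).L : ℕ) : ℝ) ^ 2 * s ^ 2 :=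
    fun j hj S c s hs0 hℓs hS => norm_dbarAvgU_sub_one_le hj c hs0 hℓs hS
  -- the flat derivative of the chart along `E` at the index
  have hflat : fderiv ℂ CL 0 E i = ((η : ℂ) * (((F.P K).L : ℕ) : ℂ) ^ J) • bondAvgIter J E cJ := by
    rw [hCL]; exact fderiv_chartLogFlat_zero_apply η D E i
  -- CASE `ρ = 0`: then `Y = 0` and the remainder's derivative at `0` vanishes
  by_cases hρz : ρ = 0
  · have hY0 : Y = 0 := by
      funext b'
      have h1 : w 1 b' * ‖Y b'‖ ≤ 0 := by rw [← hρz]; exact hY b'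
      have hw0 : 0 < w 1 b' := by rw [hw 1 b', pow_one]; positivity
      have : ‖Y b'‖ ≤ 0 := le_of_mul_le_mul_left (by rwa [mul_zero]) hw0
      exact norm_le_zero_iff.mp this
    have hdiff0 : DifferentiableAt ℂ CL 0 := by rw [hCL]; exact differentiableAt_chartLogFlat_zero η D
    have hrem0 : fderiv ℂ (fun A => CL A - fderiv ℂ CL 0 A) 0 = 0 := by
      have h := ((hdiff0.hasFDerivAt).sub (fderiv ℂ CL 0).hasFDerivAt).fderiv
      rw [sub_self] at h
      exact h
    rw [hY0]
    show ‖fderiv ℂ (fun A => CL A - fderiv ℂ CL 0 A) 0 E i‖ ≤ _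
    rw [hrem0]
    have hz : ((0 : (PBond (F.P K) 0 → Matrix (Fin 2) (Fin 2) ℂ) →L[ℂ] (BondIdx D → Matrix (Fin 2) (Fin 2) ℂ)) E) i = 0 := rfl
    rw [hz, norm_zero]
    exact hRHS0
  have hρpos : 0 < ρ := lt_of_le_of_ne hρ0 (Ne.symm hρz)
  -- differentiability at `Y`
  have hball : ∀ b', w 1 b' * ‖Y b'‖ < 2 * ρ := fun b' => (hY b').trans_lt (by linarith)
  have hRball : 16 * 3800 * ((((F.P K).d + 2) * (F.P K).L : ℕ) : ℝ) ^ 2 * (F.L : ℝ) * (2 * ρ) ≤ 1 := by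
    have : 16 * 3800 * ℓ ^ 2 * (F.L : ℝ) * (2 * ρ) = 121600 * ℓ ^ 2 * (F.L : ℝ) * ρ := by ring
    rw [this]; exact hwin1
  have hdiffY : DifferentiableAt ℂ CL Y := by
    have hOn := (differentiableOn_chartLogFlat_weightedBall_of_adm22 F n K D hDk hAdm hRM hw (C₁ := 3800) (by norm_num) hstep hRball).1
    rw [hCL]
    exact hOn.differentiableAt ((isOpen_weightedBall' F K w (2 * ρ)).mem_nhds hball)
  have hdiffRem : DifferentiableAt ℂ (fun A => CL A - fderiv ℂ CL 0 A) Y := hdiffY.sub (fderiv ℂ CL 0).differentiableAt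
  -- CASE `b` not read by the index: derivative locality
  by_cases hread : (iterBlockOf J b.src = cJ.src ∨ iterBlockOf J b.src = cJ.tgt) ∧ (iterBlockOf J b.tgt = cJ.src ∨ iterBlockOf J b.tgt = cJ.tgt)
  swap
  · have hzero : fderiv ℂ (fun A => CL A - fderiv ℂ CL 0 A) Y E i = 0 := by
      refine ChartRemainderColumnLetter.fderiv_apply_eq_zero_of_const_line (fun A => CL A - fderiv ℂ CL 0 A) Y E i hdiffRem fun t => ?_
      have htube : bondAvgIter J E cJ = 0 := by
        have h := iterTube_single_eq_zero_of_not_reads (V := Matrix (Fin 2) (Fin 2) ℂ) hJK b Mm cJ hread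
        rw [hE]
        have hL : ((F.P K).L : ℝ) ^ J ≠ 0 := pow_ne_zero _ (Nat.cast_ne_zero.mpr (F.P K).L_pos.ne')
        exact (smul_eq_zero.mp h).resolve_left hL
      have hlin : fderiv ℂ CL 0 (Y + t • E) i = fderiv ℂ CL 0 Y i := by
        rw [map_add, map_smul, Pi.add_apply, Pi.smul_apply, hflat, htube, smul_zero, smul_zero, add_zero]
      have hchart : CL (Y + t • E) i = CL Y i := by
        rw [hCL]
        exact chartLogFlat_add_of_vanish_on_read η D Y (t • E) i fun b' hbs hbt => by
          have hb' : b' ≠ b := by rintro rfl; exact hread ⟨hbs, hbt⟩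
          rw [Pi.smul_apply, hE, Pi.single_eq_of_ne hb', smul_zero]
      simp only [Pi.sub_apply, hlin, hchart]
    show ‖fderiv ℂ (fun A => CL A - fderiv ℂ CL 0 A) Y E i‖ ≤ _
    rw [hzero, norm_zero]
    exact hRHS0
  -- CASE `b` read by the index: truncate `Y` to the read cone and run the generic (157)
  set Ytr : PBond (F.P K) 0 → Matrix (Fin 2) (Fin 2) ℂ := fun b' =>
    if (iterBlockOf J b'.src = cJ.src ∨ iterBlockOf J b'.src = cJ.tgt) ∧ (iterBlockOf J b'.tgt = cJ.src ∨ iterBlockOf J b'.tgt = cJ.tgt) then Y b' else 0 with hYtr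
  set r₀ : ℝ := Lr * ρ * (Lr ^ J)⁻¹ with hr₀
  have hr₀pos : 0 < r₀ := by rw [hr₀]; positivity
  -- the global log size of the truncation
  have hYtrSize : ∀ b', ‖((η : ℂ) • Ytr) b'‖ ≤ r₀ := by
    intro b'
    rw [Pi.smul_apply]
    by_cases hb' : (iterBlockOf J b'.src = cJ.src ∨ iterBlockOf J b'.src = cJ.tgt) ∧ (iterBlockOf J b'.tgt = cJ.src ∨ iterBlockOf J b'.tgt = cJ.tgt)
    · have hval : Ytr b' = Y b' := by simp only [hYtr, if_pos hb']
      rw [hval, norm_smul, Complex.norm_real, Real.norm_of_nonneg hη0.le]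
      -- `η·Lʲ·‖Y b′‖ ≤ L·ρ` from the weighted-ball letter (with every slack `δ > 0`)
      have hle : η * Lr ^ J * ‖Y b'‖ ≤ Lr * ρ := by
        refine le_of_forall_pos_lt_add fun δ hδ => ?_
        have hA : ∀ b'', w 1 b'' * ‖Y b''‖ < ρ + δ / Lr := fun b'' => (hY b'').trans_lt (by have := div_pos hδ hL0; linarith)
        have h := weighted_read_bound_of_adm22 F n K D hDk hAdm hRM hw hA i b' hb'.1
        have : (F.L : ℝ) * (ρ + δ / (F.L : ℝ)) = (F.L : ℝ) * ρ + δ := by rw [mul_add, mul_div_cancel₀ _ hL0.ne']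
        rw [hη, hLr]; linarith [this ▸ h]
      calc η * ‖Y b'‖ = η * Lr ^ J * ‖Y b'‖ * (Lr ^ J)⁻¹ := by field_simp
        _ ≤ Lr * ρ * (Lr ^ J)⁻¹ := mul_le_mul_of_nonneg_right hle (by positivity)
    · have hval : Ytr b' = 0 := by simp only [hYtr, if_neg hb']
      rw [hval, smul_zero, norm_zero]; exact hr₀pos.le
  -- windows of the generic theorem in terms of `r₀ ≤ Lρ`
  have hLJ1 : (Lr ^ J)⁻¹ ≤ 1 := inv_le_one_of_one_le₀ (one_le_pow₀ (by linarith))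
  have hr₀le : Lr ^ J * r₀ = Lr * ρ := by rw [hr₀]; field_simp
  have hr₀le' : r₀ ≤ Lr * ρ := by
    rw [hr₀]; exact mul_le_of_le_one_right (by positivity) hLJ1
  have hr20 : r₀ ≤ 1 / 20 := hr₀le'.trans hwin4
  have hbud : 121600 * ℓ ^ 2 * ((F.P K).L : ℝ) ^ J * r₀ ≤ 1 := by
    rw [hPL, mul_assoc (121600 * ℓ ^ 2), hr₀le, ← mul_assoc]; exact hwin1
  have hRb : 51200 * ℓ * ((F.P K).L : ℝ) ^ J * r₀ ≤ 1 := by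
    rw [hPL, mul_assoc (51200 * ℓ), hr₀le, ← mul_assoc]; exact hwin2
  have hδ : (2560 * ℓ / (400 * ℓ)⁻¹) * (2 * ((F.P K).d : ℝ)) / (((F.P K).L : ℝ) ^ 2 * (((F.P K).L : ℝ) ^ (F.P K).d)⁻¹) * (16 * (((F.P K).L : ℝ) ^ J * r₀)) ≤ 1 / 12 := by
    rw [hPL, hr₀le]; exact hwin3
  -- the generic (157) on the truncation
  obtain ⟨k, hk, hderk⟩ := hasDerivAt_logTower_kernel_bound (n := Fin 2) hL3 hJK η Ytr b Mm cJ hr₀pos hr20 hYtrSize hbud hRb hδ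
  -- the chart along `Y + tE` at the index IS the log tower of the truncation along `Ytr + tE`
  have hfun : (fun t : ℂ => CL (Y + t • E) i) = fun t : ℂ => (-Complex.I) • mlog (((dbarIterU J (expCfg η (Ytr + t • (Pi.single b Mm : PBond (F.P K) 0 → Matrix (Fin 2) (Fin 2) ℂ))) cJ :
      (Matrix (Fin 2) (Fin 2) ℂ)ˣ) : Matrix (Fin 2) (Fin 2) ℂ)) := by
    funext t
    rw [hCL, chartLogFlat_congr η D i (A := Y + t • E) (A' := Ytr + t • (Pi.single b Mm : PBond (F.P K) 0 → Matrix (Fin 2) (Fin 2) ℂ)) fun b' hbs hbt => ?_,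
      chartLogFlat_apply]
    have hb' : (iterBlockOf J b'.src = cJ.src ∨ iterBlockOf J b'.src = cJ.tgt) ∧ (iterBlockOf J b'.tgt = cJ.src ∨ iterBlockOf J b'.tgt = cJ.tgt) := ⟨hbs, hbt⟩
    have hval : Ytr b' = Y b' := (congrFun hYtr b').trans (if_pos hb')
    rw [Pi.add_apply, Pi.add_apply, hval, hE]
  -- the derivative of the chart along the line, read through hCd♭
  have hline : HasDerivAt (fun t : ℂ => Y + t • E) E 0 := by
    have h := ((hasDerivAt_id (0 : ℂ)).smul_const E).const_add Y
    rwa [one_smul] at h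
  have hcomp : HasDerivAt (fun t : ℂ => CL (Y + t • E)) (fderiv ℂ CL Y E) 0 := by
    have hY0 : (fun t : ℂ => Y + t • E) 0 = Y := by simp only [zero_smul, add_zero]
    have hF : HasFDerivAt CL (fderiv ℂ CL Y) ((fun t : ℂ => Y + t • E) 0) := by rw [hY0]; exact hdiffY.hasFDerivAt
    exact hF.comp_hasDerivAt (0 : ℂ) hline
  have hcompi : HasDerivAt (fun t : ℂ => CL (Y + t • E) i) (fderiv ℂ CL Y E i) 0 := (hasDerivAt_pi.mp hcomp) i
  rw [hfun] at hcompi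
  have huniq : fderiv ℂ CL Y E i = ((η : ℂ) * (((F.P K).L : ℕ) : ℂ) ^ J) • bondAvgIter J E cJ + k := by
    rw [hE]; exact hcompi.unique hderk
  -- the remainder's derivative at `Y` along `E` at the index is `k`
  have hrem : fderiv ℂ (fun A => CL A - fderiv ℂ CL 0 A) Y E i = k := by
    have h1 : fderiv ℂ (fun A => CL A - fderiv ℂ CL 0 A) Y = fderiv ℂ CL Y - fderiv ℂ CL 0 :=
      ((hdiffY.hasFDerivAt).sub (fderiv ℂ CL 0).hasFDerivAt).fderiv
    rw [h1]
    show (fderiv ℂ CL Y E - fderiv ℂ CL 0 E) i = k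
    rw [Pi.sub_apply, huniq, hflat, add_sub_cancel_left]
  show ‖fderiv ℂ (fun A => CL A - fderiv ℂ CL 0 A) Y E i‖ ≤ _
  rw [hrem]
  refine hk.trans (le_of_eq ?_)
  -- bookkeeping of the constant: `L^J r₀ = Lρ`, `L^J·((L³)⁻¹)^J = ((L^J)⁻¹)²`, `‖η•M‖ = η‖M‖`
  have hnM : ‖(η : ℂ) • Mm‖ = η * ‖Mm‖ := by rw [norm_smul, Complex.norm_real, Real.norm_of_nonneg hη0.le]
  have hpow : Lr ^ J * ((Lr ^ (F.P K).d)⁻¹) ^ J * (η * ‖Mm‖) = ((Lr ^ J)⁻¹) ^ 2 * (η * ‖Mm‖) := by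
    have hx : Lr ^ J ≠ 0 := pow_ne_zero _ hL0.ne'
    have h3 : ((Lr ^ (F.P K).d)⁻¹) ^ J = ((Lr ^ J)⁻¹) ^ 3 := by
      rw [hPd, inv_pow, inv_pow, ← pow_mul, ← pow_mul, Nat.mul_comm]
    have h32 : ((Lr ^ J)⁻¹) ^ 3 = ((Lr ^ J)⁻¹) ^ 2 * (Lr ^ J)⁻¹ := pow_succ _ 2
    rw [h3, h32]
    congr 1
    rw [mul_left_comm, mul_inv_cancel₀ hx, mul_one]
  rw [hA', hPL, hr₀le, hnM, hpow]
  ring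

/-! ## v1.1 — the same row at an ARBITRARY `DecidableEq` instance on the fine bonds (the consumer ✓`ChartRemainderColumnLetterFlat.hCcolFlat_fderiv_of_kernel157` carries a local
`[DecidableEq (PBond (F.P K) 0)]` binder; instances are subsingletons, so the row transfers verbatim) -/

/-- ★★★ **THE (X2-C′-KERNEL) ROW FOR THE DOUBLE-BAR CHART, ANY-INSTANCE TWIN** of `kernel157_flat`: the identical statement with `Pi.single b M` read at an arbitrary
`DecidableEq (PBond (F.P K) 0)` instance (the shape of the `hK` binder of ✓`ChartRemainderColumnLetterFlat.hCcolFlat_fderiv_of_kernel157`, whose section carries a local instance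
binder); `DecidableEq` instances form a subsingleton, so this is `kernel157_flat` up to `Subsingleton.elim`. [cite: Balaban1985Averaging, Prop. 5 (157) p.42; Balaban1985Variational, (72)-(73) p.289] -/
theorem kernel157_flat' [DecidableEq (PBond (F.P K) 0)] (D : Domains (F.P K)) (hDk : D.k = K - n) {R' Mb : ℕ} (hAdm : Adm22 D R' Mb)
    (hRM : 2 * (F.P K).L ≤ R' * Mb + 1)
    {w : ℕ → PBond (F.P K) 0 → ℝ} (hw : IsLevWeight F n K D w) {ρ : ℝ} (hρ0 : 0 ≤ ρ)
    (hwin1 : 121600 * ((((F.P K).d + 2) * (F.P K).L : ℕ) : ℝ) ^ 2 * (F.L : ℝ) * ρ ≤ 1)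
    (hwin2 : 51200 * ((((F.P K).d + 2) * (F.P K).L : ℕ) : ℝ) * (F.L : ℝ) * ρ ≤ 1)
    (hwin3 : (2560 * ((((F.P K).d + 2) * (F.P K).L : ℕ) : ℝ) / (400 * ((((F.P K).d + 2) * (F.P K).L : ℕ) : ℝ))⁻¹) * (2 * ((F.P K).d : ℝ)) /
        ((F.L : ℝ) ^ 2 * ((F.L : ℝ) ^ (F.P K).d)⁻¹) * (16 * ((F.L : ℝ) * ρ)) ≤ 1 / 12)
    (hwin4 : (F.L : ℝ) * ρ ≤ 1 / 20)
    (Y : PBond (F.P K) 0 → Matrix (Fin 2) (Fin 2) ℂ) (hY : ∀ b, w 1 b * ‖Y b‖ ≤ ρ)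
    (b : PBond (F.P K) 0) (Mm : Matrix (Fin 2) (Fin 2) ℂ) (i : BondIdx D) :
    ‖fderiv ℂ (fun A : PBond (F.P K) 0 → Matrix (Fin 2) (Fin 2) ℂ =>
          chartLogFlat (((F.L : ℝ)⁻¹) ^ (K - n)) D A -
            fderiv ℂ (chartLogFlat (((F.L : ℝ)⁻¹) ^ (K - n)) D :
              (PBond (F.P K) 0 → Matrix (Fin 2) (Fin 2) ℂ) → BondIdx D → Matrix (Fin 2) (Fin 2) ℂ) 0 A) Y (Pi.single b Mm) i‖ ≤
      (16 * ((2560 * ((((F.P K).d + 2) * (F.P K).L : ℕ) : ℝ) / (400 * ((((F.P K).d + 2) * (F.P K).L : ℕ) : ℝ))⁻¹) * (2 * ((F.P K).d : ℝ)) /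
        ((F.L : ℝ) ^ 2 * ((F.L : ℝ) ^ (F.P K).d)⁻¹)) * (F.L : ℝ) / (1 - 2 / (F.L : ℝ) - 1 / 12)) *
        ρ * ((F.L : ℝ)⁻¹) ^ (K - n) * (((F.L : ℝ) ^ (i.1.1 : ℕ))⁻¹) ^ 2 * ‖Mm‖ := by
  convert kernel157_flat F n K D hDk hAdm hRM hw hρ0 hwin1 hwin2 hwin3 hwin4 Y hY b Mm i using 6

end Summit.QuantumFields.YangMills.Theorems.ChartKernelFlat

end
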